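import Summits.QuantumFields.YangMills.Theorems.CovariantDischargeSweepGapReduction
import Summits.QuantumFields.YangMills.Theorems.CovariantDischargeCombFrameSweep
import Summits.QuantumFields.YangMills.Theorems.CovariantDischargeKnitSocket
import Summits.QuantumFields.YangMills.Theorems.CovariantDischargeFarMeanThreshold
import Summits.QuantumFields.YangMills.Theorems.CovariantDischargeSandwichCapThreshold
import Summits.QuantumFields.YangMills.Theorems.CovariantDischargePlaqPairSum
import Summits.QuantumFields.YangMills.Theorems.CovariantDischargeDoorReading
import Summits.QuantumFields.YangMills.Theorems.CovariantDischargeCombLassoStokes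
import Summits.QuantumFields.YangMills.Theorems.CovariantDischargeMatchedPairCharge
import Summits.QuantumFields.YangMills.Theorems.CovariantDischargeProfileSocket
import Summits.QuantumFields.YangMills.Theorems.CovariantDischargeDoorSites
import Summits.QuantumFields.YangMills.Theorems.CovariantDischargeCombSweepLinCobdLocal
import Summits.QuantumFields.YangMills.Theorems.CovariantDischargeDoorThresholdJ0
import Summits.QuantumFields.YangMills.Theorems.CovariantDischargeDoorPhi
import Summits.QuantumFields.YangMills.Theorems.CovariantDischargeDoorSignalRows
import Summits.QuantumFields.YangMills.Theorems.CovariantDischargeCombSweepProfileGlue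
import Summits.QuantumFields.YangMills.Theorems.CovariantDischargeDoorMeans
import Summits.QuantumFields.YangMills.Theorems.CovariantDischargeDoorGlueRows
import Summits.QuantumFields.YangMills.Theorems.CovariantDischargeDoorGuardRows
import Summits.QuantumFields.YangMills.Theorems.CovariantDischargeDoorSignal
import HarnessLib

/-!
# Line «sandwich_discharge» on crux `HistoryTailL` (stmt-QuantumFields-19936; also registered on stmt-QuantumFields-24186), skeleton v5 470b3af6 —
# ★★★ THE CAPPED SWEEP-GAP STUB `stub_sandwichSweepGapCapped` (S′), CLOSED: the B6 door assembled from its landed bricks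

Cell `ym3-torus` (YM ladder rung R3 = continuum SU(2) Yang–Mills on the three-torus — a RUNG, NOT the Clay problem: not d = 4, not infinite volume,
not a mass gap); WIDTH seat `ym3-torus-px8` gen 8 (the B6 door pen), STUB mode `--supports stmt-QuantumFields-19936` (LEAD ★w1-19936 g10 word
2026-08-29T14:45:30Z).  THEOREMS ONLY (0 `def`); ONE declaration, decl-local heartbeat budget 400k with reason (README HEARTBEAT rule).

THE DOOR (memo of record HOME `ym3-torus-px8/g7/B6-DOOR-v3-CURRENCY-px8g7.md`; skeleton v5 HOME `ym3-torus-px8/g8/DOOR-SKELETON-v5-px8g8.lean`,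
kernel certificate cde9d9cd).  Constants in the stub's quantifier order: `N₁ := 77` (CAP exponent `M = 19`); after `b₀ p₀ Λ`: `m` with `(64√3Λ)² < L^m`
(far row), `γ₁` (✓`θBal_cap_le_pow`), `B_c := 3(2624 + 32·576·A_Q) + 1`, `κ := 1∕8`, `cg := κ²∕(4B_c)`, `D := 0`, `δ := 1∕2`, `N_R := ⌈1536√3·2^{p₀}·A_S⌉₊ + 12`,
`j₀ := max (max j₁ j₂) (max j₃ j₄)` over the four landed slots ((η) rows ✓`exists_j0_door_nat`, GLUE rows ✓`exists_j0_glue`, `4^{p₀} ≤ L^j`, guards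
✓`exists_j1_guards`).  Data: `h := j + m`, the coarse plaquette `P″` (✓`exists_coarsePlaq`), the profile socket ✓`exists_profile_socket` at radius
`R := N_R·L^(2j+h)` (corner `C`, profile `a_T`), the comb centre `c₀ := embIter j p.src`, the swept set `S := {b | b.src ∈ C + box(2R)}` re-centred at `c₀`
with radius `r := 2R + L^h` (✓`exists_recentred`), amplitudes `s·a_T`, `s := κθ∕(2B_cL^j)`, the sweep pair ✓`exists_sweep_pair_comb`.  Per configuration:
scalar rows (ratio ✓`θBal_le_two_rpow_mul_sqrt_inv_pow_mul`, `x = Λθ`, CAP, `θ_K ≤ θ ≤ 1`, (S5), (S6) ✓`far_mean_weight_le`, (S7) ✓`reading_conjunct_le`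
∕`reading_far_conjunct_le`∕`profile_conjunct_le`∕✓`bulk_conjunct_le_of_le`, guards ✓`guard_le_one`∕`guard_far_le_one`, GLUE ✓`glue_rest_le`), the action
side ✓`profile_signal_sub_cost_le_wilsonAction4_sub_sweepInv` (`SIG − REST ≤ A(V) − A(Ψ′V)`), the signal side ✓`door_signal` (`s·θ∕2 ≤ SIG`), the knit
`κθs − B_cL^js² ≤ A(V) − A(Ψ′V)` and ✓`capped_gap_of_sweep`.
CREDITS (cell `ym3-torus`, crux 19936 sandwich lane): px8 g6∕g7 (architecture, profile side, sites, reading, knit socket), w5 g13∕g14 (sweep pair, GLUE cost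
rows and knit, lasso), px6 g8 ((η) rows, `j₀` slot, closure defect, D6-Φ), px7 g8 ((S7) rows), px18 g6 (D6-MEANS, guards), w8 g8 (B5 letters), px15∕px16∕px20∕
w3-20520 (kernel reads).  HONEST SCOPE: this closes ONE registered stub of the line; `stub_sandwichDeep` (= `SandwichDeepWindowTailL`), the crux `HistoryTailL`
and every summit statement remain OPEN; YM₃ on T³ is rung R3 — not d = 4, not infinite volume, not a mass gap, not Clay.
-/

noncomputable section

open scoped BigOperators RealInnerProductSpace Matrix.Norms.L2Operator
open MeasureTheory
open Literature.MathematicalPhysics.QuantumFieldTheory.Balaban1983to89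
open Literature.MathematicalPhysics.QuantumFieldTheory.Balaban1983to89.T4Continuum
open Literature.MathematicalPhysics.QuantumFieldTheory.Balaban1983to89.T3ContinuumYM3Torus
open Literature.MathematicalPhysics.QuantumFieldTheory.Balaban1983to89.T3UnitScaleTilt
open Literature.MathematicalPhysics.QuantumFieldTheory.Balaban1983to89.T3UnitLawDensityEML (ℰp)
open Literature.MathematicalPhysics.QuantumFieldTheory.Balaban1983to89.T3Thresholds (θBal_eq coupling_le_one)
open Literature.MathematicalPhysics.QuantumFieldTheory.Balaban1983to89.T3ThresholdSmallness (sqrt_coupling_pos_le)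
open Literature.MathematicalPhysics.QuantumFieldTheory.Balaban1983to89.T4CubeChartGnomonic (SU2)
open Literature.MathematicalPhysics.QuantumFieldTheory.Balaban1983to89.T4HaarSU2ExpChart (expPoint)
open Literature.MathematicalPhysics.QuantumFieldTheory.Balaban1983to89.T4ExpWindowSmallField (imVec)
open Literature.MathematicalPhysics.QuantumFieldTheory.Balaban1983to89.B15Prop1ChartSU2 (adSU2)
open Literature.MathematicalPhysics.QuantumFieldTheory.Balaban1983to89.B10Eq27TorusAxialLog (transl axialT)
open Literature.MathematicalPhysics.QuantumFieldTheory.Balaban1983to89.B4Eq19LatticeOperators (Zd box mem_box unitVec)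
open Literature.MathematicalPhysics.QuantumLattice (su2Quat)
open B5Eq118OneStroke (iterBlock)
open LatticeFieldCalculus (runSite)
open Summit.QuantumFields.YangMills.Theorems.CovariantDischargeCombFrameSweep (exists_sweep_pair_comb)
open Summit.QuantumFields.YangMills.Theorems.CovariantDischargeKnitSocket (capped_gap_of_sweep)
open Summit.QuantumFields.YangMills.Theorems.CovariantDischargeSandwichCapThreshold (θBal_cap_le_pow)
open Summit.QuantumFields.YangMills.Theorems.CovariantDischargePlaqPairSum (sum_curl_mul_eq_two_mul_sum_plaq bond_sum_eq_curl)
open Summit.QuantumFields.YangMills.Theorems.CovariantDischargeProfileSocket (exists_profile_socket)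
open Summit.QuantumFields.YangMills.Theorems.CovariantDischargeDoorSites (exists_coarsePlaq transfUp_axialT_embIter corner_le_centre_lt exists_recentred)
open Summit.QuantumFields.YangMills.Theorems.CovariantDischargeDoorThresholdJ0 (exists_j0_door_nat eventually_const_le_pow)
open Summit.QuantumFields.YangMills.Theorems.CovariantDischargeDoorPhi (exists_doorPhi)
open Summit.QuantumFields.YangMills.Theorems.CovariantDischargeDoorSignalRows (reading_conjunct_le reading_far_conjunct_le profile_conjunct_le)
open Summit.QuantumFields.YangMills.Theorems.CovariantDischargeCombSweepProfileGlue (profile_signal_sub_cost_le_wilsonAction4_sub_sweepInv)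
open Summit.QuantumFields.YangMills.Theorems.CovariantDischargeDoorMeans (door_mean_le door_mean_far_le)
open Summit.QuantumFields.YangMills.Theorems.CovariantDischargeDoorGlueRows (exists_j0_glue glue_rest_le betaK_le bulk_conjunct_le_of_le)
open Summit.QuantumFields.YangMills.Theorems.CovariantDischargeDoorGuardRows (exists_j1_guards guard_le_one guard_far_le_one)
open Summit.QuantumFields.YangMills.Theorems.CovariantDischargeCombLassoStokes (dist1_gaugeAct_axialT_le_of_ball)
open Summit.QuantumFields.YangMills.Theorems.CovariantDischargeDoorSignal (door_signal far_mean_weight_le thetaK_le_theta)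
open Literature.MathematicalPhysics.QuantumFieldTheory.Balaban1983to89.B15DeterminingSets (embIter)

namespace Summit.QuantumFields.YangMills.Theorems.CovariantDischargeSandwichSweepGapCapped

set_option maxHeartbeats 400000 in
-- hb: the constants shell instantiates six large-statement bricks (profile socket, sweep pair, `glue_rest_le`, GLUE-KNIT, `door_signal`, knit socket);
-- measured 2026-08-29: passes at 250000, fails at 200000 — README HEARTBEAT rule headroom, ≤ 400k (№24 (a)).
/-- ★★★ **`stub_sandwichSweepGapCapped` — THE CAPPED SWEEP-GAP STUB (S′) of skeleton v5 470b3af6 on crux `HistoryTailL` (registered text VERBATIM).**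
For every block size `L` there is `N₁ := 77` such that for all `b₀ > 0`, `p₀ > 2`, `Λ > 1` there are `j₀, γ₁, cg, D := 0, δ := 1∕2` with: for every
member `F` (`F.L = L`), coupling `0 < γ ≤ γ₁`, base `b ≥ b₀`, coupled depth `j > j₀`, `77j + n ≤ K`, under the severity cap and `θ_{Λb}(K−j) ≤ 1`, for every
level-`j` plaquette `p` and unit axis `v` there is a measure-preserving bijection `Ψ` of the fine field space with measurable inverse `Ψ′` (the comb-framed
one-axis sweep of ✓`exists_sweep_pair_comb` along the profile ✓`exists_profile_socket`) such that on the sandwich window event the Wilson action drops by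
`≥ cg·p_{b₀}(g_{K−j})²∕β_K` under `Ψ′`.  Assembly of the door: sites ✓`CovariantDischargeDoorSites`, rows ✓`…DoorThresholdJ0` ✓`…DoorGlueRows`
✓`…DoorGuardRows`, action side ✓`…CombSweepProfileGlue` + ✓`glue_rest_le`, signal side ✓`CovariantDischargeDoorSignal.door_signal`
(✓`…DoorPhi`, ✓`…DoorMeans`, ✓`…DoorSignalRows`), knit ✓`…KnitSocket.capped_gap_of_sweep`.
[cite: Balaban1985Averaging, (10)-(12) p.19, (19)-(20) p.21, p.24; Balaban1985UV3, (3) p.256, (7) p.257; Balaban1987RG1, (0.2) p.252] -/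
theorem stub_sandwichSweepGapCapped :
    ∀ (L : ℕ), ∃ N₁ : ℕ, 0 < N₁ ∧ ∀ (b₀ p₀ Λ : ℝ), 0 < b₀ → 2 < p₀ → 1 < Λ →
    ∃ (j₀ : ℕ) (γ₁ cg D δ : ℝ), 0 < γ₁ ∧ γ₁ ≤ 1 ∧ 0 < cg ∧ 0 < δ ∧ δ ^ 2 ≤ 2 ∧
      ∀ (F : T3Family) (γ : ℝ), F.L = L → 0 < γ → γ ≤ γ₁ → ∀ (b : ℝ), b₀ ≤ b → ∀ (K n j : ℕ), j₀ < j → N₁ * j + n ≤ K →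
        b ≤ 2 * (151 * (F.L : ℝ) ^ 2) ^ j * b₀ → T3UnitScaleTilt.θBal F.L γ (Λ * b) p₀ (K - j) ≤ 1 →
        ∀ (p : Plaq (F.P K) j) (v : EuclideanSpace ℝ (Fin 3)), ‖v‖ = 1 →
          ∃ (Ψ Ψ' : GaugeField (F.P K) 0 (Matrix.specialUnitaryGroup (Fin 2) ℂ) → GaugeField (F.P K) 0 (Matrix.specialUnitaryGroup (Fin 2) ℂ)),
            MeasurePreserving Ψ (fieldMeasure (F.P K) 0 (Matrix.specialUnitaryGroup (Fin 2) ℂ)) (fieldMeasure (F.P K) 0 (Matrix.specialUnitaryGroup (Fin 2) ℂ)) ∧ Measurable Ψ' ∧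
            Function.LeftInverse Ψ' Ψ ∧ Function.RightInverse Ψ' Ψ ∧
            ∀ V : GaugeField (F.P K) 0 (Matrix.specialUnitaryGroup (Fin 2) ℂ),
              (∀ k, k < j → PlaqSmall (T3UnitScaleTilt.θBal F.L γ b p₀ (K - k))
                (Averaging.iter (fun i => BlockAveraging.blockAvg (P := F.P K) (j := i) T3UnitLawDensityEML.ℰp) k V)) →
              (∀ j', j ≤ j' → j' + n ≤ K → PlaqSmall (T3UnitScaleTilt.θBal F.L γ (Λ * b) p₀ (K - j'))
                (Averaging.iter (fun i => BlockAveraging.blockAvg (P := F.P K) (j := i) T3UnitLawDensityEML.ℰp) j' V)) →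
              (1 - δ ^ 2 / 2) * (T3UnitScaleTilt.θBal F.L γ b p₀ (K - j) *
                  Real.sqrt (1 - T3UnitScaleTilt.θBal F.L γ (Λ * b) p₀ (K - j) ^ 2 / 4)) ≤
                ⟪v, T4ExpWindowSmallField.imVec (Literature.MathematicalPhysics.QuantumLattice.su2Quat (GaugeField.plaqHol
                  (Averaging.iter (fun i => BlockAveraging.blockAvg (P := F.P K) (j := i) T3UnitLawDensityEML.ℰp) j V) p))⟫ →
              cg * B10.pFun b₀ p₀ (Real.sqrt (γ * ((F.L : ℝ)⁻¹) ^ (K - j))) ^ 2 - D ≤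
                (F.scheme T3UnitLawDensityEML.ℰp γ).β K * (wilsonAction4 V - wilsonAction4 (Ψ' V)) := by
  classical
  -- ═══ D0. absolute constants of the profile socket (before everything) ═══
  obtain ⟨A_S, A_B, A_B', A_Q, A_L, A_L', A_T, hA_S, hA_B, hA_B', hA_Q, hA_L, hA_L', hA_T, hSock⟩ := exists_profile_socket
  intro L
  -- ═══ CONSTANT N₁ (after L only): ERRATUM of record, CAP exponent M := 19 ⇒ N₁ := 4·19 + 1 = 77 ═══
  refine ⟨77, by norm_num, ?_⟩
  intro b₀ p₀ Λ hb₀ hp₀ hΛ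
  by_cases hL3 : 3 ≤ L
  swap
  · refine ⟨0, 1, 1, 0, 1, one_pos, le_rfl, one_pos, one_pos, by norm_num, ?_⟩
    intro F γ hFL
    exfalso
    have h1 : 1 < L := hFL ▸ F.hL.2
    have hodd : Odd L := hFL ▸ F.hL.1
    obtain ⟨k, hk⟩ := hodd
    omega
  have hL1 : 1 < L := by omega
  have hL1' : (1 : ℝ) < L := by exact_mod_cast hL1
  have hL0 : (0 : ℝ) < L := by linarith
  -- ═══ CONSTANTS after (b₀ p₀ Λ): m = m_Λ (B4 far row), γ₁ (CAP ✓p712249), κ, B_c, cg := κ²∕(4B_c), D := 0, δ := 1∕2, j₀ ((η) rows) ═══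
  obtain ⟨m, hm⟩ : ∃ m : ℕ, (64 * Real.sqrt 3 * Λ) ^ 2 < (L : ℝ) ^ m := pow_unbounded_of_one_lt _ hL1'
  obtain ⟨γ₁, hγ₁, hγ₁1, hCAP⟩ := θBal_cap_le_pow hL1.le (lt_trans zero_lt_one hΛ) hb₀ (by linarith : (0 : ℝ) < p₀)
  set Bc : ℝ := 3 * (2624 + 32 * 576 * A_Q) + 1 with hBc_def
  have hBc : 0 < Bc := by rw [hBc_def]; positivity
  set κ : ℝ := 1 / 8 with hκ_def
  -- N_R: the profile box radius factor, `R := N_R · L^(2j+h)` ((P″)-error row ⇒ `N_R ≥ 1536√3·2^p₀·A_S`, and `≥ 12`)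
  set N_R : ℕ := ⌈1536 * Real.sqrt 3 * (2 : ℝ) ^ p₀ * A_S⌉₊ + 12 with hNR_def
  -- ═══ THE DEPTH THRESHOLD `j₀ := max j₁ (max j₂ j₃)` — three landed slots (REAL):
  --   j₁: ✓p723049 `exists_j0_door_nat` (px6), the five (η) factor rows ≤ 1∕128 with `A₁ := 4(A_L + 3A_L′)`, + `m ≤ j₁`, `5N_R < L^j₁`;
  --   j₂: ✍`exists_j0_glue` (px8 g8), the five GLUE rows;  j₃: `4^{p₀} ≤ L^j` (so `θ_K ≤ θ ≤ 1`);  j₄: ✓p726120 `exists_j1_guards` (px18 g6), the two D6-MEANS guards.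
  have hL2 : 2 ≤ L := by omega
  obtain ⟨j₁, hj₁m, hj₁N, hj₁⟩ := exists_j0_door_nat hL3 A_B A_B' (4 * (A_L + 3 * A_L')) A_T p₀ N_R m (by norm_num : (0 : ℝ) < 1 / 128)
  obtain ⟨j₂, hj₂⟩ := exists_j0_glue hL3 A_T (4 * (A_L + 3 * A_L')) (N_R : ℝ) p₀ m
  obtain ⟨j₃, hj₃⟩ := eventually_const_le_pow hL2 ((4 : ℝ) ^ p₀)
  obtain ⟨j₄, hj₄⟩ := exists_j1_guards hL3 p₀ m
  refine ⟨max (max j₁ j₂) (max j₃ j₄), γ₁, κ ^ 2 / (4 * Bc), 0, 1 / 2, hγ₁, hγ₁1, by positivity, by norm_num, by norm_num, ?_⟩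
  -- ═══ DATA ═══
  intro F γ hFL hγ hγγ₁ b hb K n j hj₀j hK hcap hx p v hv
  have hj₁j : j₁ < j := by omega
  have hj₂j : j₂ < j := by omega
  have hj₃j : j₃ < j := by omega
  have hj₄j : j₄ < j := by omega
  have hγ1 : γ ≤ 1 := hγγ₁.trans hγ₁1
  have hb0 : 0 ≤ b := hb₀.le.trans hb
  have hjK : j ≤ K := by omega
  have hj1 : 1 ≤ j := by omega
  -- D1. sites: `h := j + m`, the coarse plaquette `P″` above `p` (✓p720252 `exists_coarsePlaq`), comb centre `c₀`
  set h : ℕ := j + m with hh_def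
  have hjh : j ≤ h := Nat.le_add_right j m
  have hhK : h ≤ (F.P K).m + (F.P K).K := by
    show j + m ≤ F.m + K
    have : m ≤ j := hj₁m.trans hj₁j.le
    omega
  -- BRICK D1a ✓p720252 `exists_coarsePlaq` (REAL)
  obtain ⟨P'', hP''μ, hP''ν, -, hnest⟩ := exists_coarsePlaq hjh hhK p
  -- D2. the profile socket at radius `R := N_R · L^(2j+h)`
  set R : ℕ := N_R * F.L ^ (2 * j + h) with hR_def
  have hNR12 : 12 ≤ N_R := by rw [hNR_def]; omega
  have hFL1 : 1 ≤ F.L := F.hL.2.le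
  have hFL2 : 2 ≤ F.L := F.hL.2
  have hR1 : 2 * (2 * (F.P K).L ^ h) + 4 ≤ R := by
    show 2 * (2 * F.L ^ h) + 4 ≤ N_R * F.L ^ (2 * j + h)
    have hpow : F.L ^ (2 * j + h) = F.L ^ (2 * j) * F.L ^ h := pow_add _ _ _
    have h4 : 4 ≤ F.L ^ (2 * j) := by
      calc 4 = 2 ^ 2 := by norm_num
        _ ≤ F.L ^ 2 := Nat.pow_le_pow_left hFL2 2
        _ ≤ F.L ^ (2 * j) := Nat.pow_le_pow_right hFL1 (by omega)
    have hh1 : 1 ≤ F.L ^ h := Nat.one_le_pow _ _ hFL1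
    rw [hpow]
    have key : 12 * (4 * F.L ^ h) ≤ N_R * (F.L ^ (2 * j) * F.L ^ h) := Nat.mul_le_mul hNR12 (Nat.mul_le_mul_right _ h4)
    omega
  have hR2 : 12 ≤ R := by
    show 12 ≤ N_R * F.L ^ (2 * j + h)
    have hh1 : 1 ≤ F.L ^ (2 * j + h) := Nat.one_le_pow _ _ hFL1
    have key : 12 * 1 ≤ N_R * F.L ^ (2 * j + h) := Nat.mul_le_mul hNR12 hh1
    omega
  -- the period guards: `5R ≤ L^(j₀ + 3j + m) ≤ L^(5j) ≤ L^(m_F + K) ≤ sitesPerDir 0 ∕ 2`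
  have hSPD : (F.P K).sitesPerDir 0 = 2 * F.L ^ (F.m + K) := by simp [Params.sitesPerDir]
  have h5R : 5 * R ≤ F.L ^ (F.m + K) := by
    rw [hR_def, hFL]
    calc 5 * (N_R * L ^ (2 * j + h)) = (5 * N_R) * L ^ (2 * j + h) := by ring
      _ ≤ L ^ j₁ * L ^ (2 * j + h) := Nat.mul_le_mul_right _ hj₁N.le
      _ = L ^ (j₁ + (2 * j + h)) := (pow_add _ _ _).symm
      _ ≤ L ^ (F.m + K) := Nat.pow_le_pow_right (by omega) (by rw [hh_def]; omega)
  have hR3 : 2 * (2 * (R : ℤ) + 3) + 1 ≤ ((F.P K).sitesPerDir 0 : ℤ) := by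
    rw [hSPD]; push_cast
    have h5R' : (5 * R : ℤ) ≤ ((F.L ^ (F.m + K) : ℕ) : ℤ) := by exact_mod_cast h5R
    push_cast at h5R'
    have hR12 : (12 : ℤ) ≤ R := by exact_mod_cast hR2
    linarith only [h5R', hR12]
  obtain ⟨C, aT, hCval, haT0, hPair, hQ, hS1, hT⟩ :=
    hSock F K j h hjh hhK p.μ p.ν (ne_of_lt p.hμν) p.src P''.src hnest R hR1 hR2 hR3
  -- BRICK D1b ✓p720252 (REAL): `c₀ := embIter j p.src`
  set c₀ : Site (F.P K) 0 := embIter j p.src with hc₀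
  have hc₀C : ∀ ν, (C ν).val ≤ (c₀ ν).val ∧ (c₀ ν).val < (C ν).val + (F.P K).L ^ h :=
    corner_le_centre_lt hjh hhK p.src P''.src C hCval hnest
  -- D3. the sweep: support `S`, amplitude `s`, profile `cb := s·aT`, framed factors `nf`, sweep pair (✓p718712)
  set θ : ℝ := θBal F.L γ b p₀ (K - j) with hθ_def
  set θK : ℝ := θBal F.L γ b p₀ K with hθK_def
  set x : ℝ := θBal F.L γ (Λ * b) p₀ (K - j) with hx_def
  set s : ℝ := κ * θ / (2 * (Bc * (F.L : ℝ) ^ j)) with hs_def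
  have hθ0 : 0 ≤ θ := by
    rw [hθ_def, θBal_eq]
    have hg := sqrt_coupling_pos_le (L := F.L) F.hL.2.le hγ (K - j)
    exact mul_nonneg hg.1.le (B10.pFun_nonneg b p₀ _ hb0 hg.1 (coupling_le_one F.hL.2.le hγ hγ1 _))
  have hθK0 : 0 ≤ θK := by
    rw [hθK_def, θBal_eq]
    have hg := sqrt_coupling_pos_le (L := F.L) F.hL.2.le hγ K
    exact mul_nonneg hg.1.le (B10.pFun_nonneg b p₀ _ hb0 hg.1 (coupling_le_one F.hL.2.le hγ hγ1 _))
  have hx0 : 0 ≤ x := by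
    rw [hx_def, θBal_eq]
    have hg := sqrt_coupling_pos_le (L := F.L) F.hL.2.le hγ (K - j)
    exact mul_nonneg hg.1.le (B10.pFun_nonneg (Λ * b) p₀ _ (mul_nonneg (zero_lt_one.trans hΛ).le hb0) hg.1 (coupling_le_one F.hL.2.le hγ hγ1 _))
  clear_value x θK θ
  set S : Finset (PBond (F.P K) 0) := Finset.univ.filter (fun bb => ∃ w ∈ box (0 : Zd (F.P K).d) (2 * (R : ℤ)), bb.src = transl C w)
    with hS_def
  set r : ℕ := 2 * R + F.L ^ h with hr_def
  -- BRICK D3a ✓p720252 `exists_recentred` (REAL)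
  have hS : ∀ bb ∈ S, ∃ z : Fin (F.P K).d → ℤ, (∀ ν, (z ν).natAbs ≤ r) ∧ bb.src = transl c₀ z := by
    intro bb hbb
    simp only [hS_def, Finset.mem_filter, Finset.mem_univ, true_and] at hbb
    obtain ⟨w, hw, hsrc⟩ := hbb
    have hw' : w ∈ box (0 : Zd (F.P K).d) ((2 * R : ℕ) : ℤ) := by push_cast; exact hw
    obtain ⟨z, hz, hCz⟩ := exists_recentred C c₀ (R := 2 * R) (M := F.L ^ h) (fun ν => (hc₀C ν).1) (fun ν => (hc₀C ν).2) hw'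
    exact ⟨z, fun ν => by rw [hr_def]; exact hz ν, by rw [hsrc, hCz]⟩
  have hr : 2 * r < (F.P K).sitesPerDir 0 := by
    rw [hSPD, hr_def]
    have hLh : F.L ^ h ≤ R := by
      have := hR1
      show F.L ^ h ≤ R
      have e : (F.P K).L = F.L := rfl
      rw [e] at this
      omega
    omega
  set cb : PBond (F.P K) 0 → ℝ := fun bb => s * aT bb with hcb_def
  set nf : PBond (F.P K) 0 → GaugeField (F.P K) 0 SU2 → SU2 := fun bb U => expPoint (cb bb • adSU2 (axialT U c₀ bb.src)⁻¹ v) with hnf_def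
  obtain ⟨Ψ, Ψ', hmp, hmeas, hli, hri, hΨ, hΨ'⟩ :=
    exists_sweep_pair_comb c₀ hr S hS v cb nf (fun _ _ => rfl)
  refine ⟨Ψ, Ψ', hmp, hmeas, hli, hri, ?_⟩
  -- ═══ ∀ V ═══
  intro V hfin hcoarse hwin
  have hθK_small : PlaqSmall θK V := by
    have h0 := hfin 0 (by omega)
    rw [Nat.sub_zero] at h0
    rw [hθK_def]
    exact h0
  -- ═══ SHARED SCALAR FACTS (REAL): ratio ✓p717307, monotonicity in `b`, CAP ✓p712249, `θ_K ≤ θ ≤ 1`, radius casts, period guards ═══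
  have hd3 : (F.P K).d = 3 := T3Family.P_d F K
  have hFL3 : 3 ≤ F.L := by rw [hFL]; exact hL3
  have hFL0 : (0 : ℝ) < F.L := by exact_mod_cast (lt_trans Nat.zero_lt_one F.hL.2)
  have hp0 : (0 : ℝ) ≤ p₀ := by linarith only [hp₀]
  have h2jK : 2 * j ≤ K := by omega
  have h77 : (4 * 19 + 1) * j ≤ K := by omega
  have hθKr : θK ≤ (2 : ℝ) ^ p₀ * Real.sqrt ((F.L : ℝ)⁻¹) ^ j * θ := by
    rw [hθK_def, hθ_def]
    exact Summit.QuantumFields.YangMills.Theorems.CovariantDischargeThresholdRatio.θBal_le_two_rpow_mul_sqrt_inv_pow_mul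
      hFL1 hγ hγ1 hb0 hp0 h2jK
  have hxΛ : x = Λ * θ := by rw [hx_def, hθ_def, θBal_eq, θBal_eq]; unfold B10.pFun; ring
  have hθx : θ ≤ x := by rw [hxΛ]; exact le_mul_of_one_le_left hθ0 hΛ.le
  have hθ1 : θ ≤ 1 := hθx.trans hx
  have hxcap : x ≤ (151 * (F.L : ℝ) ^ 2 * ((F.L : ℝ)⁻¹) ^ 19) ^ j := by
    have hcap' : b ≤ 2 * (151 * (L : ℝ) ^ 2) ^ j * b₀ := by rw [← hFL]; exact hcap
    have := hCAP γ hγ hγγ₁ b K j 19 hb0 hcap' h77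
    rw [← hFL] at this
    rw [hx_def]
    exact this
  -- `4^{p₀} ≤ L^j` ⇒ `2^{p₀}·(√L⁻¹)^j ≤ 1` ⇒ `θ_K ≤ θ`
  have hθKθ : θK ≤ θ := by
    have h4 : (4 : ℝ) ^ p₀ ≤ (F.L : ℝ) ^ j := by rw [hFL]; exact hj₃ j hj₃j
    rw [hθK_def, hθ_def]
    exact thetaK_le_theta hFL1 hγ hγ1 hb0 hp0 h2jK h4
  have hθK1 : θK ≤ 1 := hθKθ.trans hθ1
  have hRr : ((R : ℕ) : ℝ) = (N_R : ℝ) * (F.L : ℝ) ^ (2 * j + h) := by rw [hR_def]; push_cast; ring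
  have hNR1 : (1 : ℝ) ≤ (N_R : ℝ) := by exact_mod_cast (le_trans (by norm_num) hNR12)
  have hNRS : 1536 * Real.sqrt 3 * (2 : ℝ) ^ p₀ * A_S ≤ (N_R : ℝ) := by
    have hc : (1536 * Real.sqrt 3 * (2 : ℝ) ^ p₀ * A_S : ℝ) ≤ (⌈1536 * Real.sqrt 3 * (2 : ℝ) ^ p₀ * A_S⌉₊ : ℝ) := Nat.le_ceil _
    rw [hNR_def]; push_cast; linarith only [hc]
  have hRh4 : 4 * F.L ^ h + 4 ≤ R := by
    have := hR1
    show 4 * F.L ^ h + 4 ≤ R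
    have e : (F.P K).L = F.L := rfl
    rw [e] at this
    omega
  -- `L^j ≥ 6`, `L^h ≥ 6` (from `5·N_R < L^j₁ ≤ L^j ≤ L^h`, `N_R ≥ 12`)
  have hLj6 : (6 : ℝ) ≤ (F.L : ℝ) ^ j := by
    have h1 : L ^ j₁ ≤ L ^ j := Nat.pow_le_pow_right (by omega) hj₁j.le
    have h60 : 5 * 12 < L ^ j₁ := lt_of_le_of_lt (Nat.mul_le_mul_left 5 hNR12) hj₁N
    have h2 : 6 ≤ L ^ j := le_trans (by norm_num) (le_trans h60.le h1)
    rw [hFL]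
    exact_mod_cast h2
  have hLh6 : (6 : ℝ) ≤ (F.L : ℝ) ^ h :=
    hLj6.trans (pow_le_pow_right₀ (by exact_mod_cast hFL1) hjh)
  -- period guards: `2(r+2) ≤ sitesPerDir 0` (sweep∕GLUE) and `2(r+1) ≤ sitesPerDir 0` (lasso)
  have hr2 : 2 * (r + 2) ≤ (F.P K).sitesPerDir 0 := by
    rw [hSPD, hr_def]
    have hLh : F.L ^ h ≤ R := by have := hR1; show F.L ^ h ≤ R; have e : (F.P K).L = F.L := rfl; rw [e] at this; omega
    omega
  have hr1 : 2 * (r + 1) ≤ (F.P K).sitesPerDir 0 := le_trans (by omega) hr2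
  set Wt : GaugeField (F.P K) 0 SU2 := GaugeField.gaugeAct (axialT V c₀) V with hWt_def
  set SIG : ℝ := ∑ q : Plaq (F.P K) 0, s * (aT (T4WilsonLinkAffine.bond₁ q) + aT (T4WilsonLinkAffine.bond₂ q) -
      aT (T4WilsonLinkAffine.bond₃ q) - aT (T4WilsonLinkAffine.bond₄ q)) * ⟪v, imVec (su2Quat (GaugeField.plaqHol Wt q))⟫ with hSIG_def
  have hGLUE : ∃ REST : ℝ, REST ≤ s * θ / 16 + Bc * (F.L : ℝ) ^ j * s ^ 2 ∧ SIG - REST ≤ wilsonAction4 V - wilsonAction4 (Ψ' V) := by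
    -- BRICK D4+D7 (REAL): ✍`glue_rest_le` (px8 g8, the (η)-GLUE arithmetic + the guard `τ ≤ 1∕4`) ⊕ ✓GLUE-KNIT (w5 g14)
    obtain ⟨g0, g1, g2, g4, g5⟩ := hj₂ j hj₂j
    rw [← hFL] at g0 g1 g2 g4 g5
    obtain ⟨hsmall, hREST⟩ := glue_rest_le (d := (F.P K).d) hd3 hFL3 hh_def hR_def hNR12 hr_def hθ0 hθx hx hxcap hθK0 hθKr
      hA_Q hA_L hA_L' hA_T hBc_def (show s = 1 / 8 * θ / (2 * (Bc * (F.L : ℝ) ^ j)) by rw [hs_def, hκ_def]) g0 g1 g2 g4 g5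
    have haTS : ∀ bb : PBond (F.P K) 0, bb ∉ S → aT bb = 0 := by
      intro bb hbb
      apply haT0 bb
      intro w hw heq
      apply hbb
      simp only [hS_def, Finset.mem_filter, Finset.mem_univ, true_and]
      exact ⟨w, hw, heq.symm⟩
    have hs0 : 0 ≤ s := by rw [hs_def]; positivity
    have hAT0 : 0 ≤ A_T * (4 * (((F.P K).L : ℝ) ^ j) ^ 2) := by positivity
    have hA := profile_signal_sub_cost_le_wilsonAction4_sub_sweepInv (P := F.P K) (k := 0) hθK0 hθK_small c₀ hr2 hv S hS aT haTS
      hs0 hAT0 hT hS1 hQ hsmall nf (fun _ _ => rfl) Ψ' hΨ'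
    exact ⟨_, hREST, hA⟩
  -- ═══ THE SIGNAL HALF (REAL): scalar rows discharged here, then ✍`CovariantDischargeDoorSignal.door_signal` ═══
  -- (S5) the window hypothesis with `δ = 1∕2`, `x ≤ 1`: `fj ≥ (7∕8)·√(3∕4)·θ ≥ (3∕4)·θ`
  have hS5 : 3 / 4 * θ ≤ ⟪v, imVec (su2Quat (GaugeField.plaqHol
      (Averaging.iter (fun i => BlockAveraging.blockAvg (P := F.P K) (j := i) T3UnitLawDensityEML.ℰp) j V) p))⟫ := by
    have hx2 : x ^ 2 ≤ 1 := pow_le_one₀ hx0 hx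
    have hsq : (6 : ℝ) / 7 ≤ Real.sqrt (1 - x ^ 2 / 4) := Real.le_sqrt_of_sq_le (by norm_num; linarith only [hx2])
    have hw := hwin
    have hmono : θ * ((6 : ℝ) / 7) ≤ θ * Real.sqrt (1 - x ^ 2 / 4) := mul_le_mul_of_nonneg_left hsq hθ0
    have e : (1 - (1 / 2 : ℝ) ^ 2 / 2) = 7 / 8 := by norm_num
    rw [e] at hw
    linarith only [hw, hmono]
  -- (S6) ✍`far_mean_weight_le` (B4 ✓p718583 + the choice of `m`)
  have hS6 : ((((F.P K).L : ℝ) ^ j) ^ 2 / (((F.P K).L : ℝ) ^ h) ^ 2) * θBal F.L γ (Λ * b) p₀ (K - h) ≤ θ / 64 := by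
    have hm' : (64 * Real.sqrt 3 * Λ) ^ 2 < (F.L : ℝ) ^ m := by rw [hFL]; exact hm
    have hw6 := far_mean_weight_le (K := K) F.hL.2 hγ hγ1 hb0 hp0 hΛ hh_def (by omega) hm'
    rw [← hθ_def] at hw6
    show (((F.L : ℝ) ^ j) ^ 2 / ((F.L : ℝ) ^ h) ^ 2) * θBal F.L γ (Λ * b) p₀ (K - h) ≤ θ / 64
    linarith only [hw6]
  -- (S7) ✓p724030 conjuncts 1–3 (px7 g8) + ✍`bulk_conjunct_le_of_le` at the re-centred `βK ≤ 49R²θK`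
  obtain ⟨hbulk, -, hread, hfar, -⟩ := hj₁ j hj₁j
  rw [← hFL] at hbulk hread hfar
  have hβK49 : ((((2 * (F.P K).d * r + 2 : ℕ) : ℝ) ^ 2 / 4) * θK) ≤ 49 * (R : ℝ) ^ 2 * θK := by
    rw [hd3]; exact betaK_le hr_def hRh4 hθK0
  have h7a := reading_conjunct_le hFL1 hLj6 hθ0 hθx hθK0 hθKr hxcap (le_refl _) hread
  have h7b := reading_far_conjunct_le hFL1 hh_def hLj6 hθ0 hθx hθK0 hθKr hxcap (le_refl _) hfar
  have h7c := profile_conjunct_le (h := h) hFL1 hθ0 hθKr hRr hA_S hNRS hNR1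
  have h7d := bulk_conjunct_le_of_le hFL1 hh_def hθ0 hθx hθK0 hθKr hxcap hNR1 hRr hA_B hA_B' hβK49 (le_refl _) hbulk
  -- D6-MEANS guards ✓p726120 (px18 g6)
  obtain ⟨hrow0, hrowm⟩ := hj₄ j hj₄j
  rw [← hFL] at hrow0 hrowm
  have hGj := guard_le_one hFL1 hj1 hLj6 hθ0 hθx hθK0 hθKr hxcap hrow0
  have hGh := guard_far_le_one hFL1 hh_def hj1 hLh6 hθ0 hθx hθK0 hθKr hxcap hrowm
  -- ★ the signal half: `s·θ∕2 ≤ SIG`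
  have hs0 : 0 ≤ s := by rw [hs_def]; positivity
  have hSIGNAL : s * θ / 2 ≤ SIG := by
    rw [hSIG_def, hWt_def]
    have hsig := door_signal F K j h hjh (by show j + 2 ≤ F.m + K; omega) (by show h + 2 ≤ F.m + K; omega) p P''.src hnest v hv C c₀ hc₀
      hc₀C R r hr_def hr1 aT hPair hθ0 hθK0 hθK1 hs0 V hθK_small (hcoarse h hjh (by omega)) hS5
    rw [hd3] at hsig
    exact hsig hGj hGh hS6 h7a h7b h7c h7d
  -- the knit arithmetic (real; `κ = 1∕8`): `κθs − Bc L^j s² ≤ SIG − REST ≤ A(V) − A(Ψ′V)`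
  have hKNIT : κ * θBal F.L γ b p₀ (K - j) * s - Bc * (F.L : ℝ) ^ j * s ^ 2 - 0 ≤ wilsonAction4 V - wilsonAction4 (Ψ' V) := by
    obtain ⟨REST, hREST, hA⟩ := hGLUE
    have hθs : 0 ≤ s * θ := by
      have hs0 : 0 ≤ s := by rw [hs_def]; positivity
      exact mul_nonneg hs0 hθ0
    clear_value s SIG Bc κ R N_R
    rw [← hθ_def]
    have e1 : κ * θ * s = (1 / 8) * (s * θ) := by rw [hκ_def]; ring
    rw [e1]
    linarith only [hREST, hA, hSIGNAL, hθs]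
  -- D8. the socket (✓p719353): `cg·p(b₀)(g_{K−j})² − 0 ≤ β_K·(A(V) − A(Ψ′V))`
  have hfinal := capped_gap_of_sweep F hγ hγ1 hb₀.le hb hjK (κ := κ) hBc (by rw [hs_def, hθ_def]) hKNIT (by rw [mul_zero])
  simpa [hFL] using hfinal

end Summit.QuantumFields.YangMills.Theorems.CovariantDischargeSandwichSweepGapCapped

end
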